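import Literature.NumberTheory.Automorphic.FuchsianIncompleteEisenstein
import Literature.NumberTheory.Automorphic.FuchsianInvariantHeight

/-!
# Growth of the Eisenstein series of a Fuchsian group in the cusps (`Re s > 1`): `E_𝔞(·, s) ∈ ℬ_σ(Γ\ℍ)`
(Iwaniec, *Spectral Methods of Automorphic Forms*, GSM 53, §3.2 (3.11) & (3.19)–(3.20), §3.1 (the
spaces `ℬ_μ(Γ\ℍ)`), §6.1 ("it is apparent that `E_𝔞(z, s)` belongs to `ℬ_σ(Γ\ℍ)` with
`σ = Re s`"), Lemma 2.10, §2.6 (2.30) & (2.42); PDF pp. 37–39, 41, 43, 46, 84)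

Fourth brick of the series `FuchsianGroupCusps` / `FuchsianEisensteinSeries` /
`FuchsianIncompleteEisenstein` towards the general finite-volume cases of `Iwaniec2002_thm_7_4` /
`Iwaniec2002_eq_12_5` / `Iwaniec2002_thm_12_1`: the size of the Eisenstein series
`E_𝔞(z, s) = Σ_{γ ∈ Γ_𝔞\Γ} (Im σ_𝔞⁻¹γz)^s` of a GENERAL discrete `Γ ≤ SL₂(ℝ)` in the half-plane of
absolute convergence `Re s > 1`, uniformly in the cusps — the a-priori growth that makes
`E_𝔞(·, s) - [main term]` square-integrable on `Γ\ℍ` and that every method of meromorphic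
continuation (Chapter 6: (6.1)–(6.2), Lemma 6.4) starts from. Obtained here WITHOUT the Fourier
expansion (Theorem 3.4), directly from the counting Lemma 2.10 (`Fuchsian.ncard_highRows_le`).
Everything is PROVED; nothing is vendored; no fact is introduced.

1. (§1) **Sums of `(Im γz)^σ` over rows of height `≤ H`** (`sum_rowIm_rpow_le_of_le`,
   `tsum_rowIm_rpow_le_of_le`): `Σ (Im_r z)^σ ≤ c(σ)(H^σ + H^{σ-1})`, `c(σ) = 72/(1 - 2^{1-σ})`
   (`eisGrowthConst`), for `σ > 1` — the dyadic-shell estimate of `Fuchsian.sum_rowIm_rpow_le`, run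
   below an arbitrary level `H` (there `H` had to dominate all heights).
2. (§2) **At the cusp itself** (`norm_eisInfty_sub_cpow_le`; width one, `-1 ∈ Γ`):
   `|E_∞(z, s) - y^s| ≤ (c(σ)/2)(y^{-σ} + y^{1-σ})` for ALL `z = x + iy` (the rows `(0, ±1)` give
   `y^s`; the others have `|c| ≥ 1` by Shimizu's lemma, hence height `≤ 1/y`) — the `Re s > 1`
   content of (3.20), `E_𝔞(σ_𝔞z, s) = y^s + O(y^{1-σ})` as `y → ∞`; and **in a frame where all
   heights are `≤ 1/y`** (`norm_eisInfty_smul_le`): `|E_∞(gz, s)| ≤ (c(σ)/2)(y^{-σ} + y^{1-σ})`.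
3. (§3) **For a system of inequivalent cusps `𝔞ᵢ = σᵢ∞` with width-one scaling matrices**
   (`FuchsianCuspZones.exists_cuspSystem`): `|E_𝔞ᵢ(σⱼz, s)| ≤ (c(σ)/2)(y^{-σ} + y^{1-σ})` for
   `j ≠ i` (`norm_eisCusp_frame_le_of_ne`, through `one_le_abs_c_of_ne` / `im_smul_mul_im_le_one`:
   a point high in the zone of `𝔞ⱼ` has all its `𝔞ᵢ`-heights `≤ 1/y`),
   `|E_𝔞ᵢ(σᵢz, s) - y^s| ≤ (c(σ)/2)(y^{-σ} + y^{1-σ})` (`norm_eisCusp_frame_sub_cpow_le`), and, for a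
   finite volume group with a complete cusp system, **`E_𝔞ᵢ(·, s) ∈ ℬ_σ(Γ\ℍ)`**:
   `|E_𝔞ᵢ(z, s)| ≤ C y_Γ(z)^σ` for all `z` (`exists_norm_eisCusp_le_invHeight_rpow`; `y_Γ` the
   invariant height (2.42) of `FuchsianInvariantHeight`, compact core + cuspidal zones).

Not here: the constant term `δ_𝔞𝔟 y^s + φ_𝔞𝔟(s) y^{1-s}` and the exponentially small remainder of
(3.20) (Theorem 3.4), growth in `s`, anything beyond `Re s > 1`.

## References
* [Iwaniec2002] H. Iwaniec, *Spectral Methods of Automorphic Forms*, 2nd ed., GSM 53, AMS 2002,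
  §3.1–3.2 ((3.11), (3.19)–(3.20), `ℬ_μ`), PDF pp. 41–46; §6.1, PDF p. 84; Lemma 2.10 & §2.6, PDF
  pp. 37–39 (held copy `book:iwaniec2002-spectral-methods-automorphic-forms`).

Mathlib: `Summable.sum_add_tsum_compl`, `Real.tsum_le_of_sum_le`, `norm_tsum_le_tsum_norm`,
`IsCompact.exists_bound_of_continuousOn`, `Real.inv_rpow`, `Complex.norm_cpow_eq_rpow_re_of_pos`.
Literature: `rows`, `rowIm`, `highRows`, `ncard_highRows_le`, `finite_highRows`, `div_two_pow_rpow`,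
`apply_one_eq_of_mem_rows`, `im_smul_eq_rowIm`, `mem_conj_inv_iff`, `neg_one_mem_conj_iff`,
`IsDiscreteSubgroup.conj` (`FuchsianGroupCusps`); `conj_le_range'` (`FuchsianCollars`); `eisTerm`, `eisInfty`, `eisCusp`,
`summable_eisTerm`, `norm_eisTerm`, `isAutomorphic_eisCusp`, `isC2_and_eigen_eisCusp`
(`FuchsianEisensteinSeries`); `rowIm_le_inv_im` (`FuchsianIncompleteEisenstein`);
`upperRightHom_one_mem_of_periods`, `one_le_abs_c_of_ne`, `im_smul_mul_im_le_one`, `scaling_smul`,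
`cuspStrip` (`FuchsianCuspZones`); `invHeight`, `invHeight_smul`, `invHeight_frame_smul`,
`exists_pos_le_invHeight`, `exists_smul_mem_cuspStrip_of_lt`, `exists_compact_of_invHeight_le`
(`FuchsianInvariantHeight`). Nothing on the growth of Eisenstein series of a general Fuchsian group
existed (`lean search 'norm_eisInfty|norm_eisCusp|eisInfty_sub|sum_rowIm_rpow_le_of'`: no hits; the
modular files bound `E(z, s)` for `SL₂(ℤ)` only, through its explicit Fourier expansion).
-/

noncomputable section

namespace Literature.NumberTheory.Automorphic

open Matrix UpperHalfPlane
open scoped MatrixGroups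

namespace Fuchsian

variable {Γ : Subgroup (GL (Fin 2) ℝ)}

section LowRows

open _root_.MeasureTheory _root_.Set
open scoped _root_.Pointwise _root_.ENNReal _root_.Topology

/-- `2 · 2^{-σ} = 2^{1-σ} < 1` for `σ > 1`. [folklore] -/
theorem two_mul_two_rpow_neg_lt_one {σ : ℝ} (hσ : 1 < σ) : 2 * (2 : ℝ) ^ (-σ) < 1 := by
  have : 2 * (2 : ℝ) ^ (-σ) = (2 : ℝ) ^ (1 - σ) := by
    rw [Real.rpow_sub (by norm_num), Real.rpow_one, Real.rpow_neg (by norm_num), div_eq_mul_inv]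
  rw [this]
  exact Real.rpow_lt_one_of_one_lt_of_neg one_lt_two (by linarith)

/-- **The growth constant** `c(σ) = 72/(1 - 2^{1-σ})` of the bounds below (from the `2 + 36/Y` of
Lemma 2.10 summed over dyadic shells). [folklore] -/
def eisGrowthConst (σ : ℝ) : ℝ := 72 * (1 - 2 * (2 : ℝ) ^ (-σ))⁻¹

/-- `c(σ) > 0` for `σ > 1`. [folklore] -/
theorem eisGrowthConst_pos {σ : ℝ} (hσ : 1 < σ) : 0 < eisGrowthConst σ := by
  unfold eisGrowthConst
  have := two_mul_two_rpow_neg_lt_one hσ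
  positivity

/-- `72 ≤ c(σ)`. [folklore] -/
theorem le_eisGrowthConst {σ : ℝ} (hσ : 1 < σ) : 72 ≤ eisGrowthConst σ := by
  unfold eisGrowthConst
  have h1 := two_mul_two_rpow_neg_lt_one hσ
  have h0 : 0 ≤ 2 * (2 : ℝ) ^ (-σ) := by positivity
  have : 1 ≤ (1 - 2 * (2 : ℝ) ^ (-σ))⁻¹ := by
    rw [le_inv_comm₀ one_pos (by linarith), inv_one]; linarith
  nlinarith

/-- **Dyadic bound for sums of `(Im γz)^σ` over rows of bounded height** (the estimate behind the
convergence of (3.11), run below a level `H` that need not dominate all heights): if every row in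
the finite set `T` has `Im_r z ≤ H` then, with `q = 2^{-σ}`,
`Σ_{r ∈ T} (Im_r z)^σ ≤ 2H^σ/(1 - q) + 72 (H^σ/H)/(1 - 2q)` (dyadic shells `(H/2^{j+1}, H/2^j]` and
Lemma 2.10 in each shell). [cite: Iwaniec2002, Lemma 2.10 & §3.2, PDF pp. 38–39, 43] -/
theorem sum_rowIm_rpow_le_of_le
    (hΓ : Γ ≤ (Matrix.SpecialLinearGroup.toGL : SL(2, ℝ) →* GL (Fin 2) ℝ).range)
    (hd : IsDiscreteSubgroup Γ) (hT : Matrix.GeneralLinearGroup.upperRightHom (1 : ℝ) ∈ Γ)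
    (z : ℍ) {σ : ℝ} (hσ : 1 < σ) {H : ℝ} (hH : 0 < H) (T : Finset (rows Γ))
    (hle : ∀ r ∈ T, rowIm r.1 z ≤ H) :
    ∑ r ∈ T, (rowIm r.1 z) ^ σ ≤
      2 * H ^ σ * (1 - (2 : ℝ) ^ (-σ))⁻¹ + 72 * (H ^ σ / H) * (1 - 2 * (2 : ℝ) ^ (-σ))⁻¹ := by
  classical
  set q : ℝ := (2 : ℝ) ^ (-σ) with hq
  have hq0 : 0 ≤ q := by positivity
  have hq1 : q < 1 := Real.rpow_lt_one_of_one_lt_of_neg one_lt_two (by linarith)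
  have h2q0 : 0 ≤ 2 * q := by positivity
  have h2q1 : 2 * q < 1 := two_mul_two_rpow_neg_lt_one hσ
  have hHσ : 0 ≤ H ^ σ := by positivity
  -- the shell bound `a j`
  set a : ℕ → ℝ := fun j => 2 * H ^ σ * q ^ j + 72 * (H ^ σ / H) * (2 * q) ^ j with ha
  have ha0 : ∀ j, 0 ≤ a j := fun j => by positivity
  have hsum : Summable a :=
    ((summable_geometric_of_lt_one hq0 hq1).mul_left _).add
      ((summable_geometric_of_lt_one h2q0 h2q1).mul_left _)
  have htsum : ∑' j, a j = 2 * H ^ σ * (1 - q)⁻¹ + 72 * (H ^ σ / H) * (1 - 2 * q)⁻¹ := by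
    rw [ha, ((summable_geometric_of_lt_one hq0 hq1).mul_left _).tsum_add
      ((summable_geometric_of_lt_one h2q0 h2q1).mul_left _), tsum_mul_left, tsum_mul_left,
      tsum_geometric_of_lt_one hq0 hq1, tsum_geometric_of_lt_one h2q0 h2q1]
  rw [← htsum]
  -- the shell index
  have hex : ∀ r : rows Γ, ∃ j : ℕ, H / (2 : ℝ) ^ (j + 1) < rowIm r.1 z := by
    intro r
    have hpos : 0 < rowIm r.1 z := rowIm_pos (ne_zero_of_mem_rows r.2) z
    obtain ⟨j, hj⟩ := pow_unbounded_of_one_lt (H / rowIm r.1 z) (one_lt_two (α := ℝ))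
    refine ⟨j, ?_⟩
    rw [div_lt_iff₀ (by positivity)]
    rw [div_lt_iff₀ hpos] at hj
    calc H < 2 ^ j * rowIm r.1 z := hj
      _ ≤ rowIm r.1 z * 2 ^ (j + 1) := by rw [mul_comm, pow_succ]; nlinarith [hpos]
  set J : rows Γ → ℕ := fun r => Nat.find (hex r) with hJ
  have hJlow : ∀ r : rows Γ, H / (2 : ℝ) ^ (J r + 1) < rowIm r.1 z := fun r => Nat.find_spec (hex r)
  have hJup : ∀ r ∈ T, rowIm r.1 z ≤ H / (2 : ℝ) ^ (J r) := by
    intro r hrT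
    rcases Nat.eq_zero_or_pos (J r) with h0 | hpos
    · rw [h0, pow_zero, div_one]; exact hle r hrT
    · have := Nat.find_min (hex r) (m := J r - 1) (Nat.sub_lt hpos one_pos)
      have h2 : J r - 1 + 1 = J r := by omega
      rw [not_lt, h2] at this
      exact this
  -- fibrewise
  rw [← Finset.sum_fiberwise_of_maps_to (g := J) (t := T.image J) (fun r hr => Finset.mem_image_of_mem J hr)]
  have hfib : ∀ j ∈ T.image J, ∑ r ∈ T with J r = j, (rowIm r.1 z) ^ σ ≤ a j := by
    intro j _
    have hfinj := finite_highRows hΓ hd hT z (Y := H / (2 : ℝ) ^ (j + 1)) (by positivity)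
    have hterm : ∀ r ∈ T.filter (fun r => J r = j), (rowIm r.1 z) ^ σ ≤ (H / (2 : ℝ) ^ j) ^ σ := by
      intro r hr
      rw [Finset.mem_filter] at hr
      refine Real.rpow_le_rpow (rowIm_nonneg _ _) ?_ (by linarith)
      rw [← hr.2]; exact hJup r hr.1
    have hcard : ((T.filter (fun r => J r = j)).card : ℝ) ≤ 2 + 36 / (H / (2 : ℝ) ^ (j + 1)) := by
      have h1 : (T.filter (fun r => J r = j)).card ≤ hfinj.toFinset.card := by
        refine Finset.card_le_card_of_injOn (fun r => r.1) (fun r hr => ?_) (fun r _ r' _ h => Subtype.ext h)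
        rw [Finset.mem_coe, Finset.mem_filter] at hr
        rw [Finset.mem_coe, Set.Finite.mem_toFinset]
        refine ⟨r.2, ?_⟩
        rw [← hr.2]; exact hJlow r
      rw [← Set.ncard_eq_toFinset_card _ hfinj] at h1
      exact le_trans (by exact_mod_cast h1) (ncard_highRows_le hΓ hd hT z (by positivity)).2
    calc ∑ r ∈ T with J r = j, (rowIm r.1 z) ^ σ
        ≤ ∑ r ∈ T with J r = j, (H / (2 : ℝ) ^ j) ^ σ := Finset.sum_le_sum hterm
      _ = ((T.filter (fun r => J r = j)).card : ℝ) * (H / (2 : ℝ) ^ j) ^ σ := by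
          rw [Finset.sum_const, nsmul_eq_mul]
      _ ≤ (2 + 36 / (H / (2 : ℝ) ^ (j + 1))) * (H / (2 : ℝ) ^ j) ^ σ := by
          gcongr
      _ = a j := by
          rw [ha, div_two_pow_rpow hH.le σ j]
          simp only
          rw [mul_pow, pow_succ]
          field_simp
          ring
  refine (Finset.sum_le_sum hfib).trans ?_
  exact hsum.sum_le_tsum _ (fun j _ => ha0 j)

/-- The same bound in the simplified form `Σ_{r ∈ T} (Im_r z)^σ ≤ c(σ) (H^σ + H^{σ-1})`. [folklore] -/
theorem sum_rowIm_rpow_le_eisGrowthConst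
    (hΓ : Γ ≤ (Matrix.SpecialLinearGroup.toGL : SL(2, ℝ) →* GL (Fin 2) ℝ).range)
    (hd : IsDiscreteSubgroup Γ) (hT : Matrix.GeneralLinearGroup.upperRightHom (1 : ℝ) ∈ Γ)
    (z : ℍ) {σ : ℝ} (hσ : 1 < σ) {H : ℝ} (hH : 0 < H) (T : Finset (rows Γ))
    (hle : ∀ r ∈ T, rowIm r.1 z ≤ H) :
    ∑ r ∈ T, (rowIm r.1 z) ^ σ ≤ eisGrowthConst σ * (H ^ σ + H ^ (σ - 1)) := by
  refine (sum_rowIm_rpow_le_of_le hΓ hd hT z hσ hH T hle).trans ?_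
  have hq0 : 0 ≤ (2 : ℝ) ^ (-σ) := by positivity
  have h2q1 := two_mul_two_rpow_neg_lt_one hσ
  have hHσ : 0 ≤ H ^ σ := by positivity
  have hHσ' : 0 ≤ H ^ (σ - 1) := by positivity
  have e : H ^ σ / H = H ^ (σ - 1) := by rw [Real.rpow_sub_one hH.ne']
  rw [e, eisGrowthConst]
  have hinv : (1 - (2 : ℝ) ^ (-σ))⁻¹ ≤ (1 - 2 * (2 : ℝ) ^ (-σ))⁻¹ :=
    inv_anti₀ (by linarith) (by linarith)
  have hinv0 : 0 ≤ (1 - 2 * (2 : ℝ) ^ (-σ))⁻¹ := by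
    have : 0 < 1 - 2 * (2 : ℝ) ^ (-σ) := by linarith
    positivity
  nlinarith [mul_nonneg hHσ hinv0, mul_nonneg hHσ (sub_nonneg.mpr hinv)]

/-- **Series form**: for any set `S` of rows of height `≤ H` at `z`,
`Σ_{r ∈ S} (Im_r z)^σ ≤ c(σ) (H^σ + H^{σ-1})`. [cite: Iwaniec2002, Lemma 2.10 & §3.2, PDF pp. 38–39, 43] -/
theorem tsum_rowIm_rpow_le_of_le
    (hΓ : Γ ≤ (Matrix.SpecialLinearGroup.toGL : SL(2, ℝ) →* GL (Fin 2) ℝ).range)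
    (hd : IsDiscreteSubgroup Γ) (hT : Matrix.GeneralLinearGroup.upperRightHom (1 : ℝ) ∈ Γ)
    (z : ℍ) {σ : ℝ} (hσ : 1 < σ) {H : ℝ} (hH : 0 < H) (S : Set (rows Γ))
    (hle : ∀ r ∈ S, rowIm r.1 z ≤ H) :
    ∑' r : S, (rowIm r.1.1 z) ^ σ ≤ eisGrowthConst σ * (H ^ σ + H ^ (σ - 1)) := by
  classical
  refine Real.tsum_le_of_sum_le (fun r => Real.rpow_nonneg (rowIm_nonneg _ _) σ) fun u => ?_
  have e : ∑ x ∈ u, (rowIm x.1.1 z) ^ σ =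
      ∑ r ∈ u.map (Function.Embedding.subtype _), (rowIm r.1 z) ^ σ := by
    rw [Finset.sum_map]; rfl
  rw [e]
  refine sum_rowIm_rpow_le_eisGrowthConst hΓ hd hT z hσ hH _ fun r hr => ?_
  rw [Finset.mem_map] at hr
  obtain ⟨x, -, rfl⟩ := hr
  exact hle x.1 x.2

end LowRows

/-! ## 2. The Eisenstein series near its own cusp and in the other frames -/

section Growth

open _root_.MeasureTheory _root_.Set
open scoped _root_.Pointwise _root_.ENNReal _root_.Topology

/-- **(3.20) for `Re s > 1`, at the cusp itself**: for `Γ ≤ SL₂(ℝ)` discrete with `-1 ∈ Γ` and the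
cusp `∞` of width one, `|E_∞(z, s) - y^s| ≤ (c(σ)/2)(y^{-σ} + y^{1-σ})`, `σ = Re s`, for every
`z = x + iy` — the rows `(0, ±1)` contribute `y^s`, all others have `c ≠ 0`, height `≤ 1/y`, and
are summed by Lemma 2.10. (The book's `E(σ_𝔞z, s) = y^s + φ(s)y^{1-s} + O(…)` refines this via
the Fourier expansion.) [cite: Iwaniec2002, §3.2 (3.11) & (3.20), PDF pp. 43, 46] -/
theorem norm_eisInfty_sub_cpow_le
    (hΓ : Γ ≤ (Matrix.SpecialLinearGroup.toGL : SL(2, ℝ) →* GL (Fin 2) ℝ).range)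
    (hneg : (-1 : GL (Fin 2) ℝ) ∈ Γ) (hd : IsDiscreteSubgroup Γ)
    (hT : Matrix.GeneralLinearGroup.upperRightHom (1 : ℝ) ∈ Γ) {s : ℂ} (hs : 1 < s.re) (z : ℍ) :
    ‖eisInfty Γ z s - ((z.im : ℝ) : ℂ) ^ s‖ ≤
      eisGrowthConst s.re / 2 * (z.im ^ (-s.re) + z.im ^ (1 - s.re)) := by
  classical
  set f : rows Γ → ℂ := fun r => eisTerm s r.1 z with hf
  have hfs : Summable f := summable_eisTerm hΓ hd hT hs z
  set r₁ : rows Γ := ⟨((1 : GL (Fin 2) ℝ) : Matrix (Fin 2) (Fin 2) ℝ) 1, row_mem_rows Γ.one_mem⟩ with hr₁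
  set r₂ : rows Γ := ⟨((-1 : GL (Fin 2) ℝ) : Matrix (Fin 2) (Fin 2) ℝ) 1, row_mem_rows hneg⟩ with hr₂
  have hr₁0 : r₁.1 0 = 0 := by simp [hr₁]
  have hr₁1 : r₁.1 1 = 1 := by simp [hr₁]
  have hr₂0 : r₂.1 0 = 0 := by simp [hr₂, Units.val_neg]
  have hr₂1 : r₂.1 1 = -1 := by simp [hr₂, Units.val_neg]
  have hne : r₁ ≠ r₂ := by
    intro h
    have := congrArg (fun r : rows Γ => r.1 1) h
    simp only [hr₁1, hr₂1] at this
    norm_num at this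
  have him : ∀ r : rows Γ, r.1 0 = 0 → (r.1 1 = 1 ∨ r.1 1 = -1) → rowIm r.1 z = z.im := by
    intro r h0 h1
    rw [rowIm, normSq_rowDenom, h0]
    rcases h1 with h | h <;> simp [h]
  have hf₁ : f r₁ = ((z.im : ℝ) : ℂ) ^ s := by
    simp only [hf, eisTerm, him r₁ hr₁0 (Or.inl hr₁1)]
  have hf₂ : f r₂ = ((z.im : ℝ) : ℂ) ^ s := by
    simp only [hf, eisTerm, him r₂ hr₂0 (Or.inr hr₂1)]
  set s₀ : Finset (rows Γ) := {r₁, r₂} with hs₀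
  have hsplit := hfs.sum_add_tsum_compl (s := s₀)
  have hsum₀ : ∑ x ∈ s₀, f x = 2 * ((z.im : ℝ) : ℂ) ^ s := by
    rw [hs₀, Finset.sum_pair hne, hf₁, hf₂]; ring
  have e : eisInfty Γ z s - ((z.im : ℝ) : ℂ) ^ s = (1 / 2) * ∑' x : ↑((s₀ : Set (rows Γ))ᶜ), f x := by
    unfold eisInfty
    rw [← hsplit, hsum₀]; ring
  -- rows outside `s₀` have `c ≠ 0`, hence height `≤ 1/y`
  have hlow : ∀ r ∈ ((s₀ : Set (rows Γ))ᶜ), rowIm r.1 z ≤ 1 / z.im := by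
    intro r hr
    apply rowIm_le_inv_im hΓ hd hT r.2
    intro h0
    apply hr
    rcases apply_one_eq_of_mem_rows hΓ hd hT r.2 h0 with h1 | h1
    · have : r = r₁ := Subtype.ext (funext fun j => by
        fin_cases j
        · simp [h0, hr₁0]
        · simp [h1, hr₁1])
      simp [hs₀, this]
    · have : r = r₂ := Subtype.ext (funext fun j => by
        fin_cases j
        · simp [h0, hr₂0]
        · simp [h1, hr₂1])
      simp [hs₀, this]
  have hy : 0 < 1 / z.im := by have := z.im_pos; positivity
  have hbound := tsum_rowIm_rpow_le_of_le hΓ hd hT z hs hy ((s₀ : Set (rows Γ))ᶜ) hlow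
  have hnorm : ‖∑' x : ↑((s₀ : Set (rows Γ))ᶜ), f x‖ ≤
      ∑' x : ↑((s₀ : Set (rows Γ))ᶜ), (rowIm x.1.1 z) ^ s.re := by
    refine (norm_tsum_le_tsum_norm (hfs.norm.subtype _)).trans (le_of_eq (tsum_congr fun x => ?_))
    exact norm_eisTerm (ne_zero_of_mem_rows x.1.2) s z
  have epow : (1 / z.im) ^ s.re + (1 / z.im) ^ (s.re - 1) = z.im ^ (-s.re) + z.im ^ (1 - s.re) := by
    rw [one_div, Real.inv_rpow z.im_pos.le, Real.inv_rpow z.im_pos.le, ← Real.rpow_neg z.im_pos.le,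
      ← Real.rpow_neg z.im_pos.le, neg_sub]
  rw [epow] at hbound
  rw [e, norm_mul, show ‖(1 / 2 : ℂ)‖ = 1 / 2 by norm_num]
  calc 1 / 2 * ‖∑' x : ↑((s₀ : Set (rows Γ))ᶜ), f x‖
      ≤ 1 / 2 * (eisGrowthConst s.re * (z.im ^ (-s.re) + z.im ^ (1 - s.re))) := by
        gcongr; exact hnorm.trans hbound
    _ = _ := by ring

/-- **The Eisenstein series in a frame where all heights are `≤ 1/y`**: if `g ∈ SL₂(ℝ)` and
`Im(γ g z) · Im z ≤ 1` for every `γ ∈ Γ` (the situation of a point `g z` seen from a cusp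
INEQUIVALENT to `∞`, `FuchsianCuspZones.im_smul_mul_im_le_one`), then
`|E_∞(g z, s)| ≤ (c(σ)/2)(y^{-σ} + y^{1-σ})`. [cite: Iwaniec2002, §3.2 (3.20) & Lemma 2.10, PDF pp. 38–39, 46] -/
theorem norm_eisInfty_smul_le
    (hΓ : Γ ≤ (Matrix.SpecialLinearGroup.toGL : SL(2, ℝ) →* GL (Fin 2) ℝ).range)
    (hd : IsDiscreteSubgroup Γ) (hT : Matrix.GeneralLinearGroup.upperRightHom (1 : ℝ) ∈ Γ)
    {s : ℂ} (hs : 1 < s.re) (g : GL (Fin 2) ℝ) (z : ℍ)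
    (hlow : ∀ γ ∈ Γ, ((γ * g) • z).im * z.im ≤ 1) :
    ‖eisInfty Γ (g • z) s‖ ≤ eisGrowthConst s.re / 2 * (z.im ^ (-s.re) + z.im ^ (1 - s.re)) := by
  classical
  set f : rows Γ → ℂ := fun r => eisTerm s r.1 (g • z) with hf
  have hfs : Summable f := summable_eisTerm hΓ hd hT hs (g • z)
  have hy : 0 < 1 / z.im := by have := z.im_pos; positivity
  have hle : ∀ r : rows Γ, rowIm r.1 (g • z) ≤ 1 / z.im := by
    intro r
    obtain ⟨γ, hγ, hr⟩ := r.2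
    rw [← hr, ← im_smul_eq_rowIm (hΓ hγ), ← mul_smul, le_div_iff₀ z.im_pos]
    exact hlow γ hγ
  have hbound : ∑' r : rows Γ, (rowIm r.1 (g • z)) ^ s.re ≤
      eisGrowthConst s.re * ((1 / z.im) ^ s.re + (1 / z.im) ^ (s.re - 1)) :=
    Real.tsum_le_of_sum_le (fun r => Real.rpow_nonneg (rowIm_nonneg _ _) _) fun u =>
      sum_rowIm_rpow_le_eisGrowthConst hΓ hd hT (g • z) hs hy u fun r _ => hle r
  have hnorm : ‖∑' r : rows Γ, f r‖ ≤ ∑' r : rows Γ, (rowIm r.1 (g • z)) ^ s.re := by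
    refine (norm_tsum_le_tsum_norm hfs.norm).trans (le_of_eq (tsum_congr fun r => ?_))
    exact norm_eisTerm (ne_zero_of_mem_rows r.2) s (g • z)
  have epow : (1 / z.im) ^ s.re + (1 / z.im) ^ (s.re - 1) = z.im ^ (-s.re) + z.im ^ (1 - s.re) := by
    rw [one_div, Real.inv_rpow z.im_pos.le, Real.inv_rpow z.im_pos.le, ← Real.rpow_neg z.im_pos.le,
      ← Real.rpow_neg z.im_pos.le, neg_sub]
  rw [epow] at hbound
  unfold eisInfty
  rw [norm_mul, show ‖(1 / 2 : ℂ)‖ = 1 / 2 by norm_num]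
  calc 1 / 2 * ‖∑' r : rows Γ, f r‖
      ≤ 1 / 2 * (eisGrowthConst s.re * (z.im ^ (-s.re) + z.im ^ (1 - s.re))) := by
        gcongr; exact hnorm.trans hbound
    _ = _ := by ring

end Growth

/-! ## 3. In the frames of a system of inequivalent cusps -/

section CuspSystem

open _root_.MeasureTheory _root_.Set
open scoped _root_.Pointwise _root_.ENNReal _root_.Topology

variable {h : ℕ} {𝔞 : Fin h → OnePoint ℝ} {σ : Fin h → SL(2, ℝ)}

/-- **`E_𝔞ᵢ` in the frame of another cusp `𝔞ⱼ`, `j ≠ i`** (for a system of inequivalent cusps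
with width-one scaling matrices, `FuchsianCuspZones.exists_cuspSystem`):
`|E_𝔞ᵢ(σⱼ z, s)| ≤ (c(σ)/2)(y^{-σ} + y^{1-σ})` for all `z`, `σ = Re s > 1` — in particular
`E_𝔞ᵢ` is bounded in the cuspidal zones of the other cusps.
[cite: Iwaniec2002, §3.2 (3.20) ("`E_𝔞(σ_𝔟z, s) = δ_𝔞𝔟 y^s + …`"), PDF p. 46; §2.6 (2.30), PDF p. 37] -/
theorem norm_eisCusp_frame_le_of_ne
    (hΓ : Γ ≤ (Matrix.SpecialLinearGroup.toGL : SL(2, ℝ) →* GL (Fin 2) ℝ).range)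
    (hd : IsDiscreteSubgroup Γ)
    (hinfty : ∀ i, (Matrix.SpecialLinearGroup.toGL (σ i) : GL (Fin 2) ℝ) • (OnePoint.infty : OnePoint ℝ) = 𝔞 i)
    (hper : ∀ i, (ConjAct.toConjAct (Matrix.SpecialLinearGroup.toGL (σ i) : GL (Fin 2) ℝ)⁻¹ • Γ).strictPeriods =
      AddSubgroup.zmultiples 1)
    (hineq : ∀ i j, ∀ γ ∈ Γ, γ • 𝔞 i = 𝔞 j → i = j)
    {s : ℂ} (hs : 1 < s.re) {i j : Fin h} (hij : i ≠ j) (z : ℍ) :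
    ‖eisCusp Γ (σ i) (σ j • z) s‖ ≤ eisGrowthConst s.re / 2 * (z.im ^ (-s.re) + z.im ^ (1 - s.re)) := by
  set Sᵢ : GL (Fin 2) ℝ := Matrix.SpecialLinearGroup.toGL (σ i) with hSᵢ
  set Γᵢ : Subgroup (GL (Fin 2) ℝ) := ConjAct.toConjAct Sᵢ⁻¹ • Γ with hΓᵢ
  have hΓᵢle : Γᵢ ≤ (Matrix.SpecialLinearGroup.toGL : SL(2, ℝ) →* GL (Fin 2) ℝ).range :=
    conj_le_range' hΓ (σ i)
  have hdᵢ : IsDiscreteSubgroup Γᵢ := hd.conj _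
  have hTᵢ : Matrix.GeneralLinearGroup.upperRightHom (1 : ℝ) ∈ Γᵢ := upperRightHom_one_mem_of_periods (hper i)
  have ee : ∀ (x : SL(2, ℝ)) (w : ℍ), (Matrix.SpecialLinearGroup.toGL x : GL (Fin 2) ℝ) • w = x • w :=
    fun x w => rfl
  set g : GL (Fin 2) ℝ := Matrix.SpecialLinearGroup.toGL ((σ i)⁻¹ * σ j) with hg
  have ept : (σ i)⁻¹ • σ j • z = g • z := by
    rw [← ee (σ j) z, ← ee (σ i)⁻¹, ← mul_smul, ← map_mul]
  show ‖eisInfty Γᵢ ((σ i)⁻¹ • σ j • z) s‖ ≤ _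
  rw [ept]
  refine norm_eisInfty_smul_le hΓᵢle hdᵢ hTᵢ hs g z fun γ' hγ' => ?_
  -- `γ' = σᵢ⁻¹ δ σᵢ` with `δ ∈ Γ`, so `γ' g = σᵢ⁻¹ (δ σⱼ)` and `δσⱼ` scales the cusp `δ𝔞ⱼ ≠ 𝔞ᵢ`
  have hδ : Sᵢ * γ' * Sᵢ⁻¹ ∈ Γ := (mem_conj_inv_iff Sᵢ γ').mp hγ'
  obtain ⟨δ, hδe⟩ := hΓ hδ
  have hδmem : (Matrix.SpecialLinearGroup.toGL δ : GL (Fin 2) ℝ) ∈ Γ := by rw [hδe]; exact hδ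
  obtain ⟨hτ, hperτ⟩ := scaling_smul (hinfty j) (hper j) hδmem
  have hne : 𝔞 i ≠ (Matrix.SpecialLinearGroup.toGL δ : GL (Fin 2) ℝ) • 𝔞 j := by
    intro he
    exact hij (hineq j i _ hδmem he.symm).symm
  have hc := one_le_abs_c_of_ne hΓ hd (hinfty i) (hper i) hτ hperτ hne
  have hprod : γ' * g = Matrix.SpecialLinearGroup.toGL ((σ i)⁻¹ * (δ * σ j)) := by
    have e1 : γ' = Sᵢ⁻¹ * (Sᵢ * γ' * Sᵢ⁻¹) * Sᵢ := by group
    rw [e1, ← hδe, hg, hSᵢ, map_mul, map_mul, map_mul, map_inv]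
    group
  rw [hprod]
  refine im_smul_mul_im_le_one ⟨_, rfl⟩ ?_ z
  exact hc

/-- **`E_𝔞ᵢ` in its own frame**: `|E_𝔞ᵢ(σᵢ z, s) - y^s| ≤ (c(σ)/2)(y^{-σ} + y^{1-σ})` for all `z`
(`σ = Re s > 1`, `-1 ∈ Γ`). [cite: Iwaniec2002, §3.2 (3.20), PDF p. 46] -/
theorem norm_eisCusp_frame_sub_cpow_le
    (hΓ : Γ ≤ (Matrix.SpecialLinearGroup.toGL : SL(2, ℝ) →* GL (Fin 2) ℝ).range)
    (hneg : (-1 : GL (Fin 2) ℝ) ∈ Γ) (hd : IsDiscreteSubgroup Γ)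
    (hper : ∀ i, (ConjAct.toConjAct (Matrix.SpecialLinearGroup.toGL (σ i) : GL (Fin 2) ℝ)⁻¹ • Γ).strictPeriods =
      AddSubgroup.zmultiples 1)
    {s : ℂ} (hs : 1 < s.re) (i : Fin h) (z : ℍ) :
    ‖eisCusp Γ (σ i) (σ i • z) s - ((z.im : ℝ) : ℂ) ^ s‖ ≤
      eisGrowthConst s.re / 2 * (z.im ^ (-s.re) + z.im ^ (1 - s.re)) := by
  set Sᵢ : GL (Fin 2) ℝ := Matrix.SpecialLinearGroup.toGL (σ i) with hSᵢ
  set Γᵢ : Subgroup (GL (Fin 2) ℝ) := ConjAct.toConjAct Sᵢ⁻¹ • Γ with hΓᵢ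
  have hΓᵢle : Γᵢ ≤ (Matrix.SpecialLinearGroup.toGL : SL(2, ℝ) →* GL (Fin 2) ℝ).range :=
    conj_le_range' hΓ (σ i)
  have hdᵢ : IsDiscreteSubgroup Γᵢ := hd.conj _
  have hTᵢ : Matrix.GeneralLinearGroup.upperRightHom (1 : ℝ) ∈ Γᵢ := upperRightHom_one_mem_of_periods (hper i)
  have hnegᵢ : (-1 : GL (Fin 2) ℝ) ∈ Γᵢ := (neg_one_mem_conj_iff _).mpr hneg
  show ‖eisInfty Γᵢ ((σ i)⁻¹ • σ i • z) s - _‖ ≤ _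
  rw [inv_smul_smul]
  exact norm_eisInfty_sub_cpow_le hΓᵢle hnegᵢ hdᵢ hTᵢ hs z

/-- **`E_𝔞 ∈ ℬ_σ(Γ\ℍ)`**: for a finite volume group with a complete system of inequivalent cusps,
`|E_𝔞ᵢ(z, s)| ≤ C y_Γ(z)^σ` for all `z ∈ ℍ` (`σ = Re s > 1`, `y_Γ` the invariant height (2.42)):
bounded on the compact core, `≍ y^σ` in the zone of `𝔞ᵢ`, bounded in the other zones.
[cite: Iwaniec2002, §3.1 (`ℬ_μ`), §3.2 (3.20), §6.1 ("`E_𝔞(z, s)` belongs to `ℬ_σ(Γ\ℍ)`"), PDF pp. 41, 46, 84] -/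
theorem exists_norm_eisCusp_le_invHeight_rpow {F : Set ℍ}
    (hΓ : Γ ≤ (Matrix.SpecialLinearGroup.toGL : SL(2, ℝ) →* GL (Fin 2) ℝ).range)
    (hneg : (-1 : GL (Fin 2) ℝ) ∈ Γ) (hd : IsDiscreteSubgroup Γ) (hF : IsHypFundamentalDomain Γ F)
    (hvol : volume F < ⊤)
    (hinfty : ∀ i, (Matrix.SpecialLinearGroup.toGL (σ i) : GL (Fin 2) ℝ) • (OnePoint.infty : OnePoint ℝ) = 𝔞 i)
    (hper : ∀ i, (ConjAct.toConjAct (Matrix.SpecialLinearGroup.toGL (σ i) : GL (Fin 2) ℝ)⁻¹ • Γ).strictPeriods =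
      AddSubgroup.zmultiples 1)
    (hineq : ∀ i j, ∀ γ ∈ Γ, γ • 𝔞 i = 𝔞 j → i = j)
    (hcomplete : ∀ c : OnePoint ℝ, IsCusp c Γ → ∃ i, ∃ γ ∈ Γ, γ • 𝔞 i = c)
    {s : ℂ} (hs : 1 < s.re) (i : Fin h) :
    ∃ C : ℝ, 0 ≤ C ∧ ∀ z : ℍ, ‖eisCusp Γ (σ i) z s‖ ≤ C * invHeight Γ σ z ^ s.re := by
  have ee : ∀ (x : SL(2, ℝ)) (w : ℍ), (Matrix.SpecialLinearGroup.toGL x : GL (Fin 2) ℝ) • w = x • w :=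
    fun x w => rfl
  have hTᵢ : Matrix.GeneralLinearGroup.upperRightHom (1 : ℝ) ∈
      ConjAct.toConjAct (Matrix.SpecialLinearGroup.toGL (σ i) : GL (Fin 2) ℝ)⁻¹ • Γ :=
    upperRightHom_one_mem_of_periods (hper i)
  have hcont : Continuous fun z => eisCusp Γ (σ i) z s := (isC2_and_eigen_eisCusp hΓ hd (σ i) hTᵢ hs).1
  have haut := isAutomorphic_eisCusp hΓ (σ i) s
  obtain ⟨K, hK, hcov⟩ := exists_compact_of_invHeight_le hΓ hneg hd hF hvol hinfty hper hcomplete 1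
  obtain ⟨c₀, hc₀, hc₀le⟩ := exists_pos_le_invHeight hΓ hneg hd hF hvol hinfty hper hcomplete i
  obtain ⟨M, hM⟩ := hK.exists_bound_of_continuousOn hcont.continuousOn
  set c : ℝ := eisGrowthConst s.re with hc
  have hcpos : 0 < c := eisGrowthConst_pos hs
  have hσ0 : 0 < s.re := by linarith
  set C : ℝ := max (max M 0 / c₀ ^ s.re) (1 + c) with hC
  refine ⟨C, le_trans (by positivity) (le_max_left _ _), fun z => ?_⟩
  have hyz : 0 < invHeight Γ σ z := hc₀.trans_le (hc₀le z)
  by_cases hle : invHeight Γ σ z ≤ 1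
  · -- on the compact core
    obtain ⟨γ, hγ, hγK⟩ := hcov z hle
    have e1 : eisCusp Γ (σ i) z s = eisCusp Γ (σ i) (γ • z) s := (haut γ hγ z).symm
    rw [e1]
    have h1 : ‖eisCusp Γ (σ i) (γ • z) s‖ ≤ max M 0 := (hM _ hγK).trans (le_max_left _ _)
    have h2 : max M 0 ≤ max M 0 / c₀ ^ s.re * invHeight Γ σ z ^ s.re := by
      rw [div_mul_eq_mul_div, le_div_iff₀ (by positivity)]
      exact mul_le_mul_of_nonneg_left (Real.rpow_le_rpow hc₀.le (hc₀le z) hσ0.le) (le_max_right _ _)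
    calc ‖eisCusp Γ (σ i) (γ • z) s‖ ≤ max M 0 / c₀ ^ s.re * invHeight Γ σ z ^ s.re := h1.trans h2
      _ ≤ C * invHeight Γ σ z ^ s.re := by gcongr; exact le_max_left _ _
  · -- high in a cuspidal zone
    rw [not_le] at hle
    obtain ⟨γ, hγ, j, u, hu, e⟩ := exists_smul_mem_cuspStrip_of_lt hper zero_le_one hle
    have hu1 : 1 < u.im := hu.2.2
    have hyu : invHeight Γ σ z = u.im := by
      rw [← invHeight_smul hγ z, ← e]
      exact invHeight_frame_smul hΓ hneg hd hinfty hper hineq j hu1.le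
    have e1 : eisCusp Γ (σ i) z s = eisCusp Γ (σ i) (σ j • u) s := by
      have h1 : eisCusp Γ (σ i) (γ • z) s = eisCusp Γ (σ i) z s := haut γ hγ z
      rw [← h1, ← e, ee]
    rw [e1, hyu]
    have hupos : 0 < u.im := u.im_pos
    have hp1 : u.im ^ (-s.re) ≤ u.im ^ s.re :=
      Real.rpow_le_rpow_of_exponent_le hu1.le (by linarith)
    have hp2 : u.im ^ (1 - s.re) ≤ u.im ^ s.re :=
      Real.rpow_le_rpow_of_exponent_le hu1.le (by linarith)
    have hσpos : 0 ≤ u.im ^ s.re := by positivity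
    have htail : c / 2 * (u.im ^ (-s.re) + u.im ^ (1 - s.re)) ≤ c * u.im ^ s.re := by
      nlinarith
    by_cases hji : j = i
    · subst hji
      have hmain := norm_eisCusp_frame_sub_cpow_le hΓ hneg hd hper hs j u
      have hn : ‖((u.im : ℝ) : ℂ) ^ s‖ = u.im ^ s.re := Complex.norm_cpow_eq_rpow_re_of_pos hupos s
      calc ‖eisCusp Γ (σ j) (σ j • u) s‖
          ≤ ‖eisCusp Γ (σ j) (σ j • u) s - ((u.im : ℝ) : ℂ) ^ s‖ + ‖((u.im : ℝ) : ℂ) ^ s‖ :=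
            norm_le_norm_sub_add _ _
        _ ≤ c * u.im ^ s.re + u.im ^ s.re := by rw [hn]; exact add_le_add (hmain.trans htail) le_rfl
        _ = (1 + c) * u.im ^ s.re := by ring
        _ ≤ C * u.im ^ s.re := by gcongr; exact le_max_right _ _
    · have hmain := norm_eisCusp_frame_le_of_ne hΓ hd hinfty hper hineq hs (Ne.symm hji) u
      calc ‖eisCusp Γ (σ i) (σ j • u) s‖ ≤ c * u.im ^ s.re := hmain.trans htail
        _ ≤ (1 + c) * u.im ^ s.re := by nlinarith
        _ ≤ C * u.im ^ s.re := by gcongr; exact le_max_right _ _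

end CuspSystem

end Fuchsian

end Literature.NumberTheory.Automorphic

end
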